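import Summits.QuantumFields.YangMills.Theorems.CutoffNotchTransportHistoryTailOfNotchRated
import HarnessLib

/-!
# K2's body from a per-plaquette tail with a HEIGHT-POLYNOMIAL level loss `(β_h^B)^j` — the bookkeeping a RELAXED notch constant
# `A·β_h^{N_A}` needs (route `CutoffNotchTransport`, crux stmt-QuantumFields-26202; route-independent, no `Theses` import)

Seat `ym-line-sfw-p1` g11 (home cell `ym-idea-1`), `--supports stmt-QuantumFields-26202 --as helper`; sequel of `…HistoryTailOfNotchRated`
(this seat, p615576: level-GEOMETRIC loss `R^j`).

WHY.  The registered stub `stub_notchZero` of the crux asks for a notch constant `A` uniform in `K` and `γ`, which is equipartition-grade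
(evidence `evid-26202-notchZero.md`); the ideator's card offers the relaxation `A·β_h^{N_A}`.  Along the notch chain `(K,j) → … → (h,0)` the
height `h` is constant, so the relaxed constant accumulates to `A^j·(β_h^{N_A})^j` — a loss `e^{O(h²·log(L/γ))}` on the constrained heights
`j ≤ m(h+1)`, which the tree's `perHeight_bound` (Gaussian in `h` from the LINEAR minorant `p(g_h) ≥ ½b₀·h·log L`) does not absorb.  Here:
* `historyTailAt_of_perPlaquette_rated_constrained` — the rated bookkeeping with its hypothesis asked ONLY on the constrained pairs
  `j ≤ K ∧ j ≤ m(K − j + 1)` (same proof as the landed all-heights form);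
* `beta_pow_mul_exp_neg_le` — `(β_h^B)^j·e^{−(c/2)p(g_h)²} ≤ e^{α²/(2cb₀²)}` for `j ≤ m(h+1)`, `p₀ ≥ 2` (`log β_h = 2(u−1)`, `h log L ≤ 2(u−1)`,
  `p(g_h) = b₀u^{p₀} ≥ b₀u²`, `u = 1 + log g_h⁻¹ ≥ 1`; complete the square);
* ★★ `historyTailAt_of_perPlaquette_hrated` — `C·R^j·β_h^A·(β_h^B)^j·e^{−c p²}` at every level ⇒ `HistoryTailAt F γ b₀ p₀ m` (`m ≥ 1`, `p₀ ≥ 2`).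

HONEST FRAMING.  Bookkeeping only; no estimate of Bałaban's is asserted; the crux and rung R3 (a RECORD rung) stay open; the YM mass gap is NOT
proved.  No `def`, no `sorry`.

References: T. Bałaban, CMP **102** (1985) 255–275 [Balaban1985UV3] ((7) p.257, (71) p.273); C. King, CMP **102** (1986) 649–677 [King1986]
((3.12) p.657).
-/

set_option autoImplicit false

noncomputable section

open MeasureTheory
open scoped BigOperators

namespace Summit.QuantumFields.YangMills.Theorems.CutoffNotchTransport

open Literature.MathematicalPhysics.QuantumFieldTheory
open Literature.MathematicalPhysics.QuantumFieldTheory.Balaban1983to89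
open Literature.MathematicalPhysics.QuantumFieldTheory.Balaban1983to89.T3ContinuumYM3Torus
open Literature.MathematicalPhysics.QuantumFieldTheory.Balaban1983to89.T3UnitScaleTilt
open Literature.MathematicalPhysics.QuantumFieldTheory.Balaban1983to89.T3UnitLawDensityEML (ℰp)
open Literature.MathematicalPhysics.QuantumFieldTheory.Balaban1983to89.T3CruxEstimates (real_not_plaqSmall_comp_le_sum)
open Literature.MathematicalPhysics.QuantumFieldTheory.Balaban1983to89.T3AveragedTailProfile (perHeight_bound)
open Literature.MathematicalPhysics.QuantumFieldTheory.Balaban1983to89.T3HistoryTailReduction (summable_comp_div real_compl_histGood_le_sum)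

/-! ## §1 The constrained-heights form of the rated bookkeeping -/

/-- ★★ **CONSTRAINED-HEIGHTS FORM** of `historyTailAt_of_perPlaquette_rated`: the rated per-plaquette tail is asked only for the pairs
`(K, j)` with `j ≤ K` AND `j ≤ m·(K − j + 1)` — the only ones `histGood … K ⌊K/m⌋` / `histGood … (K+1) ⌊K/m⌋` constrain.  Same proof.
[cite: Balaban1985UV3, (7) p.257 and (71) p.273; King1986, (3.12) p.657] -/
theorem historyTailAt_of_perPlaquette_rated_constrained (F : T3Family) {γ b₀ p₀ : ℝ} (hγ : 0 < γ) (hγ1 : γ ≤ 1) (hb₀ : 0 < b₀)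
    (hp₀ : 1 ≤ p₀) {m : ℕ} (hm : 0 < m) {C R c : ℝ} {A : ℕ} (hC : 0 ≤ C) (hR : 1 ≤ R) (hc : 0 < c)
    (h : ∀ (K j : ℕ), j ≤ K → j ≤ m * (K - j + 1) → ∀ p : Plaq (F.P K) j,
      (gibbsK F ℰp γ K).real
          {U | θBal F.L γ b₀ p₀ (K - j) ≤
            GaugeGroup.dist1 (GaugeField.plaqHol
              (Averaging.iter (fun i => BlockAveraging.blockAvg (P := F.P K) (j := i) ℰp) j U) p)} ≤
        C * R ^ j * (γ * ((F.L : ℝ)⁻¹) ^ (K - j))⁻¹ ^ A *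
          Real.exp (-(c * B10.pFun b₀ p₀ (Real.sqrt (γ * ((F.L : ℝ)⁻¹) ^ (K - j))) ^ 2))) :
    HistoryTailAt F γ b₀ p₀ m := by
  have hL1 : (1 : ℝ) < F.L := by exact_mod_cast F.hL.2
  have hL0 : (0 : ℝ) < F.L := one_pos.trans hL1
  obtain ⟨N'', hN''⟩ := pow_unbounded_of_one_lt (R ^ m) hL1
  have hRm0 : 0 ≤ R ^ m := pow_nonneg (zero_le_one.trans hR) m
  set C' : ℝ := C * R ^ m with hC'
  have hC'0 : 0 ≤ C' := mul_nonneg hC hRm0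
  set A' : ℝ := 72 * C' * (F.L : ℝ) ^ (3 * F.m) * γ⁻¹ ^ (A + N'') *
      Real.exp ((((3 : ℝ) + (A + N'' : ℕ)) * Real.log F.L + Real.log 2) ^ 2 / (4 * (c * b₀ ^ 2 * Real.log F.L ^ 2 / 4))) with hA'
  have hA'0 : 0 ≤ A' := by rw [hA']; positivity
  have hheight : ∀ K j : ℕ, j ≤ K → j ≤ m * (K - j + 1) →
      (gibbsK F ℰp γ K).real
          {U | ¬ PlaqSmall (θBal F.L γ b₀ p₀ (K - j))
            (Averaging.iter (fun i => BlockAveraging.blockAvg (P := F.P K) (j := i) ℰp) j U)} ≤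
        A' * ((1 : ℝ) / 2) ^ (K - j) := by
    intro K j hjK hjm
    haveI := isProbabilityMeasure_gibbsK F ℰp hγ.le K
    set hh := K - j with hhdef
    have hβ : (F.L : ℝ) ^ hh ≤ (γ * ((F.L : ℝ)⁻¹) ^ hh)⁻¹ := pow_le_beta F hγ hγ1 hh
    have hβ0 : 0 ≤ (γ * ((F.L : ℝ)⁻¹) ^ hh)⁻¹ := (pow_pos hL0 hh).le.trans hβ
    have hrate : R ^ j * (γ * ((F.L : ℝ)⁻¹) ^ hh)⁻¹ ^ A ≤ R ^ m * (γ * ((F.L : ℝ)⁻¹) ^ hh)⁻¹ ^ (A + N'') := by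
      have h1 : R ^ j ≤ R ^ m * (R ^ m) ^ hh := pow_le_pow_mul_pow hR hjm
      have h2 : (R ^ m) ^ hh ≤ (γ * ((F.L : ℝ)⁻¹) ^ hh)⁻¹ ^ N'' :=
        calc (R ^ m) ^ hh ≤ ((F.L : ℝ) ^ N'') ^ hh := pow_le_pow_left₀ hRm0 hN''.le hh
          _ = ((F.L : ℝ) ^ hh) ^ N'' := by rw [← pow_mul, ← pow_mul, mul_comm]
          _ ≤ (γ * ((F.L : ℝ)⁻¹) ^ hh)⁻¹ ^ N'' := pow_le_pow_left₀ (pow_pos hL0 hh).le hβ N''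
      calc R ^ j * (γ * ((F.L : ℝ)⁻¹) ^ hh)⁻¹ ^ A ≤ (R ^ m * (R ^ m) ^ hh) * (γ * ((F.L : ℝ)⁻¹) ^ hh)⁻¹ ^ A :=
            mul_le_mul_of_nonneg_right h1 (pow_nonneg hβ0 A)
        _ ≤ (R ^ m * (γ * ((F.L : ℝ)⁻¹) ^ hh)⁻¹ ^ N'') * (γ * ((F.L : ℝ)⁻¹) ^ hh)⁻¹ ^ A :=
            mul_le_mul_of_nonneg_right (mul_le_mul_of_nonneg_left h2 hRm0) (pow_nonneg hβ0 A)
        _ = R ^ m * (γ * ((F.L : ℝ)⁻¹) ^ hh)⁻¹ ^ (A + N'') := by rw [pow_add]; ring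
    have hplaq : ∀ p : Plaq (F.P K) j,
        (gibbsK F ℰp γ K).real
            {U | θBal F.L γ b₀ p₀ hh ≤
              GaugeGroup.dist1 (GaugeField.plaqHol
                (Averaging.iter (fun i => BlockAveraging.blockAvg (P := F.P K) (j := i) ℰp) j U) p)} ≤
          C' * (F.scheme ℰp γ).β hh ^ (A + N'') *
            Real.exp (-(c * B10.pFun b₀ p₀ (Real.sqrt (γ * ((F.L : ℝ)⁻¹) ^ hh)) ^ 2)) := by
      intro p
      refine (h K j hjK hjm p).trans ?_
      show C * R ^ j * (γ * ((F.L : ℝ)⁻¹) ^ hh)⁻¹ ^ A * _ ≤ C * R ^ m * (γ * ((F.L : ℝ)⁻¹) ^ hh)⁻¹ ^ (A + N'') * _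
      have := mul_le_mul_of_nonneg_left hrate hC
      have hexp0 : 0 ≤ Real.exp (-(c * B10.pFun b₀ p₀ (Real.sqrt (γ * ((F.L : ℝ)⁻¹) ^ hh)) ^ 2)) := (Real.exp_pos _).le
      calc C * R ^ j * (γ * ((F.L : ℝ)⁻¹) ^ hh)⁻¹ ^ A * Real.exp (-(c * B10.pFun b₀ p₀ (Real.sqrt (γ * ((F.L : ℝ)⁻¹) ^ hh)) ^ 2))
          = (C * (R ^ j * (γ * ((F.L : ℝ)⁻¹) ^ hh)⁻¹ ^ A)) * Real.exp (-(c * B10.pFun b₀ p₀ (Real.sqrt (γ * ((F.L : ℝ)⁻¹) ^ hh)) ^ 2)) := by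
            ring
        _ ≤ (C * (R ^ m * (γ * ((F.L : ℝ)⁻¹) ^ hh)⁻¹ ^ (A + N''))) *
              Real.exp (-(c * B10.pFun b₀ p₀ (Real.sqrt (γ * ((F.L : ℝ)⁻¹) ^ hh)) ^ 2)) :=
            mul_le_mul_of_nonneg_right this hexp0
        _ = _ := by ring
    have hunion := real_not_plaqSmall_comp_le_sum (gibbsK F ℰp γ K)
      (fun U => Averaging.iter (fun i => BlockAveraging.blockAvg (P := F.P K) (j := i) ℰp) j U) (θBal F.L γ b₀ p₀ hh)
    refine hunion.trans ?_
    refine (Finset.sum_le_sum fun p _ => hplaq p).trans ?_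
    rw [Finset.sum_const, Finset.card_univ, nsmul_eq_mul]
    have hnonneg : 0 ≤ C' * (F.scheme ℰp γ).β hh ^ (A + N'') *
        Real.exp (-(c * B10.pFun b₀ p₀ (Real.sqrt (γ * ((F.L : ℝ)⁻¹) ^ hh)) ^ 2)) :=
      mul_nonneg (mul_nonneg hC'0 (pow_nonneg (F.scheme_β_nonneg ℰp hγ.le hh) _)) (Real.exp_nonneg _)
    refine (mul_le_mul_of_nonneg_right (card_plaq_le_height F hjK) hnonneg).trans ?_
    rw [hA', show (72 : ℝ) * (F.L : ℝ) ^ (3 * F.m) * ((F.L : ℝ) ^ hh) ^ 3 = 9 * (8 * (F.L : ℝ) ^ (3 * F.m) * ((F.L : ℝ) ^ hh) ^ 3) by ring]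
    exact perHeight_bound F hγ hγ1 hb₀ hp₀ hC'0 (A + N'') hc hh
  refine ⟨fun K => 4 * A' * ((1 : ℝ) / 2) ^ (K / m), ?_, fun K => ⟨?_, ?_⟩⟩
  · have hs : Summable (fun n : ℕ => 4 * A' * ((1 : ℝ) / 2) ^ n) :=
      (summable_geometric_of_lt_one (by norm_num) (by norm_num)).mul_left (4 * A')
    exact summable_comp_div (T := fun n => 4 * A' * ((1 : ℝ) / 2) ^ n) (fun n => by positivity) hs hm
  · haveI := isProbabilityMeasure_gibbsK F ℰp hγ.le K
    beta_reduce
    have hKm : K < m * (K / m + 1) := Nat.lt_mul_div_succ K hm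
    have hn : K / m ≤ K := Nat.div_le_self K m
    generalize hq : K / m = q at hKm hn ⊢
    clear hq
    refine (real_compl_histGood_le_sum F ℰp (θBal F.L γ b₀ p₀) K q (gibbsK F ℰp γ K)).trans ?_
    have e1 : K - q + q = K := Nat.sub_add_cancel hn
    refine (Finset.sum_le_sum fun j hj => hheight K j ?_ ?_).trans ?_
    · have := Finset.mem_range.mp hj; omega
    · have := Finset.mem_range.mp hj
      have h1 : q + 1 ≤ K - j + 1 := by omega
      calc j ≤ K := by omega
        _ ≤ m * (q + 1) := hKm.le
        _ ≤ m * (K - j + 1) := Nat.mul_le_mul_left m h1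
    · rw [← Finset.mul_sum]
      calc A' * ∑ j ∈ Finset.range (K - q + 1), ((1 : ℝ) / 2) ^ (K - j) ≤ A' * (2 * ((1 : ℝ) / 2) ^ q) :=
            mul_le_mul_of_nonneg_left (sum_range_half_pow_le hn) hA'0
        _ ≤ 4 * A' * ((1 : ℝ) / 2) ^ q := by nlinarith [pow_nonneg (by norm_num : (0 : ℝ) ≤ 1 / 2) q]
  · haveI := isProbabilityMeasure_gibbsK F ℰp hγ.le (K + 1)
    beta_reduce
    have hKm : K < m * (K / m + 1) := Nat.lt_mul_div_succ K hm
    have hn : K / m ≤ K + 1 := (Nat.div_le_self K m).trans (Nat.le_succ K)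
    generalize hq : K / m = q at hKm hn ⊢
    clear hq
    refine (real_compl_histGood_le_sum F ℰp (θBal F.L γ b₀ p₀) (K + 1) q (gibbsK F ℰp γ (K + 1))).trans ?_
    have e1 : K + 1 - q + q = K + 1 := Nat.sub_add_cancel hn
    refine (Finset.sum_le_sum fun j hj => hheight (K + 1) j ?_ ?_).trans ?_
    · have := Finset.mem_range.mp hj; omega
    · have := Finset.mem_range.mp hj
      have h1 : q + 1 ≤ K + 1 - j + 1 := by omega
      calc j ≤ K + 1 := by omega
        _ ≤ m * (q + 1) := Nat.succ_le_of_lt hKm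
        _ ≤ m * (K + 1 - j + 1) := Nat.mul_le_mul_left m h1
    · rw [← Finset.mul_sum]
      calc A' * ∑ j ∈ Finset.range (K + 1 - q + 1), ((1 : ℝ) / 2) ^ (K + 1 - j) ≤ A' * (2 * ((1 : ℝ) / 2) ^ q) :=
            mul_le_mul_of_nonneg_left (sum_range_half_pow_le hn) hA'0
        _ ≤ 4 * A' * ((1 : ℝ) / 2) ^ q := by nlinarith [pow_nonneg (by norm_num : (0 : ℝ) ≤ 1 / 2) q]

/-- **The height-polynomial loss is harmless on the constrained heights** (`2 ≤ p₀`, `0 < b₀`, `0 < γ ≤ 1`, `j ≤ m(h+1)`, `h = K − j`):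
`(β_h^B)^j · exp(−(c/2)·p(g_h)²) ≤ exp(α²/(2c b₀²))` with `α = 2Bm(2/log L + 1)`: `log β_h = 2(u − 1)`, `h·log L ≤ 2(u − 1)` for
`u = 1 + log g_h⁻¹ ≥ 1`, so the loss is `≤ e^{αu²}`, while `p(g_h) = b₀u^{p₀} ≥ b₀u²` (complete the square). [cite: Balaban1985UV3, (7) p.257] -/
theorem beta_pow_mul_exp_neg_le (F : T3Family) {γ b₀ p₀ : ℝ} (hγ : 0 < γ) (hγ1 : γ ≤ 1) (hb₀ : 0 < b₀) (hp₀ : 2 ≤ p₀)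
    {m : ℕ} {c : ℝ} (hc : 0 < c) (B : ℕ) {j h : ℕ} (hjm : j ≤ m * (h + 1)) :
    ((γ * ((F.L : ℝ)⁻¹) ^ h)⁻¹ ^ B) ^ j * Real.exp (-(c / 2 * B10.pFun b₀ p₀ (Real.sqrt (γ * ((F.L : ℝ)⁻¹) ^ h)) ^ 2)) ≤
      Real.exp ((2 * B * m * (2 / Real.log F.L + 1)) ^ 2 / (2 * c * b₀ ^ 2)) := by
  have hL1 : (1 : ℝ) < F.L := by exact_mod_cast F.hL.2
  have hL0 : (0 : ℝ) < F.L := one_pos.trans hL1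
  set ℓ : ℝ := Real.log F.L with hℓ
  have hℓ0 : 0 < ℓ := Real.log_pos hL1
  -- the coupling and the log variable `u`
  set x : ℝ := γ * ((F.L : ℝ)⁻¹) ^ h with hx
  have hx0 : 0 < x := mul_pos hγ (pow_pos (inv_pos.mpr hL0) h)
  set g : ℝ := Real.sqrt x with hg
  have hg0 : 0 < g := Real.sqrt_pos.mpr hx0
  have hlogγ : Real.log γ ≤ 0 := Real.log_nonpos hγ.le hγ1
  have hlogg : Real.log g⁻¹ = (h * ℓ - Real.log γ) / 2 := by
    rw [Real.log_inv, hg, Real.log_sqrt hx0.le, hx, Real.log_mul hγ.ne' (pow_ne_zero _ (inv_ne_zero hL0.ne')),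
      Real.log_pow, Real.log_inv]
    ring
  set u : ℝ := 1 + Real.log g⁻¹ with hu
  have hu1 : 1 ≤ u := by
    rw [hu, hlogg]; have : 0 ≤ (h : ℝ) * ℓ := by positivity
    linarith
  have hu0 : 0 ≤ u := zero_le_one.trans hu1
  have hlogβ : Real.log x⁻¹ = 2 * (u - 1) := by
    rw [Real.log_inv, hx, Real.log_mul hγ.ne' (pow_ne_zero _ (inv_ne_zero hL0.ne')), Real.log_pow, Real.log_inv, hu, hlogg]
    ring
  have hhℓ : (h : ℝ) * ℓ ≤ 2 * (u - 1) := by rw [hu, hlogg]; linarith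
  -- the loss `(β^B)^j ≤ exp(α u²)`
  set α : ℝ := 2 * B * m * (2 / ℓ + 1) with hα
  have hα0 : 0 ≤ α := by positivity
  have hloss : (x⁻¹ ^ B) ^ j ≤ Real.exp (α * u ^ 2) := by
    have hβ1 : 1 ≤ x⁻¹ := by
      rw [one_le_inv₀ hx0, hx]
      exact mul_le_one₀ hγ1 (pow_nonneg (inv_nonneg.mpr hL0.le) h)
        (pow_le_one₀ (inv_nonneg.mpr hL0.le) (inv_le_one_of_one_le₀ hL1.le))
    have hpow : (x⁻¹ ^ B) ^ j ≤ (x⁻¹ ^ B) ^ (m * (h + 1)) := pow_le_pow_right₀ (one_le_pow₀ hβ1) hjm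
    refine hpow.trans ?_
    rw [← pow_mul, ← Real.exp_log (pow_pos (inv_pos.mpr hx0) _), Real.log_pow, hlogβ]
    refine Real.exp_le_exp.mpr ?_
    have hh1 : ((h : ℝ) + 1) ≤ (2 / ℓ + 1) * u := by
      have : (h : ℝ) ≤ 2 * (u - 1) / ℓ := by rw [le_div_iff₀ hℓ0]; linarith
      have h2 : 2 * (u - 1) / ℓ ≤ 2 / ℓ * u := by
        rw [div_mul_eq_mul_div, div_le_div_iff_of_pos_right hℓ0]; linarith
      nlinarith
    have hcast : ((B * (m * (h + 1)) : ℕ) : ℝ) = (B : ℝ) * m * ((h : ℝ) + 1) := by push_cast; ring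
    rw [hcast]
    have hB0 : (0 : ℝ) ≤ (B : ℝ) * m := by positivity
    calc (B : ℝ) * m * ((h : ℝ) + 1) * (2 * (u - 1)) ≤ (B : ℝ) * m * ((2 / ℓ + 1) * u) * (2 * u) := by
          apply mul_le_mul (mul_le_mul_of_nonneg_left hh1 hB0) (by linarith) (by linarith [hu1])
          positivity
      _ = α * u ^ 2 := by rw [hα]; ring
  -- the gain `p(g)² ≥ b₀² u⁴`
  have hpF : B10.pFun b₀ p₀ g = b₀ * u ^ p₀ := rfl
  have hup : u ^ 2 ≤ u ^ p₀ := by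
    have := Real.rpow_le_rpow_of_exponent_le hu1 hp₀
    rwa [Real.rpow_two] at this
  have hp2 : b₀ ^ 2 * u ^ 4 ≤ B10.pFun b₀ p₀ g ^ 2 := by
    rw [hpF, mul_pow]
    have h4 : u ^ 4 = (u ^ 2) ^ 2 := by ring
    rw [h4]
    exact mul_le_mul_of_nonneg_left (pow_le_pow_left₀ (sq_nonneg u) hup 2) (sq_nonneg b₀)
  -- combine: `α u² − (c/2) b₀² u⁴ ≤ α²/(2 c b₀²)`
  have hexp_le : Real.exp (-(c / 2 * B10.pFun b₀ p₀ g ^ 2)) ≤ Real.exp (-(c / 2 * (b₀ ^ 2 * u ^ 4))) :=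
    Real.exp_le_exp.mpr (by nlinarith [mul_le_mul_of_nonneg_left hp2 (by positivity : (0 : ℝ) ≤ c / 2)])
  have hquad : α * u ^ 2 + -(c / 2 * (b₀ ^ 2 * u ^ 4)) ≤ α ^ 2 / (2 * c * b₀ ^ 2) := by
    have hcb : 0 < 2 * c * b₀ ^ 2 := by positivity
    rw [le_div_iff₀ hcb]
    nlinarith [sq_nonneg (c * b₀ ^ 2 * u ^ 2 - α), sq_nonneg u]
  calc (x⁻¹ ^ B) ^ j * Real.exp (-(c / 2 * B10.pFun b₀ p₀ g ^ 2))
      ≤ Real.exp (α * u ^ 2) * Real.exp (-(c / 2 * (b₀ ^ 2 * u ^ 4))) :=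
        mul_le_mul hloss hexp_le (Real.exp_pos _).le (Real.exp_pos _).le
    _ = Real.exp (α * u ^ 2 + -(c / 2 * (b₀ ^ 2 * u ^ 4))) := (Real.exp_add _ _).symm
    _ ≤ Real.exp (α ^ 2 / (2 * c * b₀ ^ 2)) := Real.exp_le_exp.mpr hquad

/-- ★★ **HEIGHT-POLYNOMIALLY RATED FORM**: a per-plaquette tail `C·R^j·β_h^A·(β_h^B)^j·e^{−c·p(g_h)²}` at every level `j ≤ K` — the shape the
notch induction produces from a RELAXED notch constant `A·β_h^{B}` (the ideator's «glue-compatible relaxation») — still gives `HistoryTailAt … m`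
for every `m ≥ 1`, provided `p₀ ≥ 2`: the extra loss is absorbed by half of the Gaussian on the constrained heights (`beta_pow_mul_exp_neg_le`).
[cite: Balaban1985UV3, (7) p.257 and (71) p.273; King1986, (3.12) p.657] -/
theorem historyTailAt_of_perPlaquette_hrated (F : T3Family) {γ b₀ p₀ : ℝ} (hγ : 0 < γ) (hγ1 : γ ≤ 1) (hb₀ : 0 < b₀) (hp₀ : 2 ≤ p₀)
    {m : ℕ} (hm : 0 < m) {C R c : ℝ} {A B : ℕ} (hC : 0 ≤ C) (hR : 1 ≤ R) (hc : 0 < c)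
    (h : ∀ (K j : ℕ), j ≤ K → ∀ p : Plaq (F.P K) j,
      (gibbsK F ℰp γ K).real
          {U | θBal F.L γ b₀ p₀ (K - j) ≤
            GaugeGroup.dist1 (GaugeField.plaqHol
              (Averaging.iter (fun i => BlockAveraging.blockAvg (P := F.P K) (j := i) ℰp) j U) p)} ≤
        C * R ^ j * (γ * ((F.L : ℝ)⁻¹) ^ (K - j))⁻¹ ^ A * ((γ * ((F.L : ℝ)⁻¹) ^ (K - j))⁻¹ ^ B) ^ j *
          Real.exp (-(c * B10.pFun b₀ p₀ (Real.sqrt (γ * ((F.L : ℝ)⁻¹) ^ (K - j))) ^ 2))) :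
    HistoryTailAt F γ b₀ p₀ m := by
  set E : ℝ := Real.exp ((2 * B * m * (2 / Real.log F.L + 1)) ^ 2 / (2 * c * b₀ ^ 2)) with hE
  refine historyTailAt_of_perPlaquette_rated_constrained F hγ hγ1 hb₀ (by linarith) hm (C := C * E) (R := R) (A := A)
    (c := c / 2) (by positivity) hR (by positivity) ?_
  intro K j hjK hjm p
  refine (h K j hjK p).trans ?_
  have habs := beta_pow_mul_exp_neg_le F hγ hγ1 hb₀ hp₀ (m := m) hc B (j := j) (h := K - j) hjm
  have hsplit : Real.exp (-(c * B10.pFun b₀ p₀ (Real.sqrt (γ * ((F.L : ℝ)⁻¹) ^ (K - j))) ^ 2)) =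
      Real.exp (-(c / 2 * B10.pFun b₀ p₀ (Real.sqrt (γ * ((F.L : ℝ)⁻¹) ^ (K - j))) ^ 2)) *
        Real.exp (-(c / 2 * B10.pFun b₀ p₀ (Real.sqrt (γ * ((F.L : ℝ)⁻¹) ^ (K - j))) ^ 2)) := by
    rw [← Real.exp_add]; congr 1; ring
  have h0 : 0 ≤ C * R ^ j * (γ * ((F.L : ℝ)⁻¹) ^ (K - j))⁻¹ ^ A *
      Real.exp (-(c / 2 * B10.pFun b₀ p₀ (Real.sqrt (γ * ((F.L : ℝ)⁻¹) ^ (K - j))) ^ 2)) := by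
    have hR0 : 0 ≤ R := zero_le_one.trans hR
    positivity
  rw [hsplit]
  calc C * R ^ j * (γ * ((F.L : ℝ)⁻¹) ^ (K - j))⁻¹ ^ A * ((γ * ((F.L : ℝ)⁻¹) ^ (K - j))⁻¹ ^ B) ^ j *
        (Real.exp (-(c / 2 * B10.pFun b₀ p₀ (Real.sqrt (γ * ((F.L : ℝ)⁻¹) ^ (K - j))) ^ 2)) *
          Real.exp (-(c / 2 * B10.pFun b₀ p₀ (Real.sqrt (γ * ((F.L : ℝ)⁻¹) ^ (K - j))) ^ 2)))
      = (C * R ^ j * (γ * ((F.L : ℝ)⁻¹) ^ (K - j))⁻¹ ^ A *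
          Real.exp (-(c / 2 * B10.pFun b₀ p₀ (Real.sqrt (γ * ((F.L : ℝ)⁻¹) ^ (K - j))) ^ 2))) *
        (((γ * ((F.L : ℝ)⁻¹) ^ (K - j))⁻¹ ^ B) ^ j *
          Real.exp (-(c / 2 * B10.pFun b₀ p₀ (Real.sqrt (γ * ((F.L : ℝ)⁻¹) ^ (K - j))) ^ 2))) := by ring
    _ ≤ (C * R ^ j * (γ * ((F.L : ℝ)⁻¹) ^ (K - j))⁻¹ ^ A *
          Real.exp (-(c / 2 * B10.pFun b₀ p₀ (Real.sqrt (γ * ((F.L : ℝ)⁻¹) ^ (K - j))) ^ 2))) * E :=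
        mul_le_mul_of_nonneg_left habs h0
    _ = C * E * R ^ j * (γ * ((F.L : ℝ)⁻¹) ^ (K - j))⁻¹ ^ A *
          Real.exp (-(c / 2 * B10.pFun b₀ p₀ (Real.sqrt (γ * ((F.L : ℝ)⁻¹) ^ (K - j))) ^ 2)) := by ring

end Summit.QuantumFields.YangMills.Theorems.CutoffNotchTransport

end
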